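import Literature.NumberTheory.EllipticCurves.TwoDescent
import Literature.NumberTheory.EllipticCurves.KramerDescentSelmerTwoSpanProofs
import HarnessLib

/-!
# E-es-185 STEP 2, `E`-free — PRELIMINARIES: square classes of conductor-`q` representatives, their independence at
# distinct primes (`v_q`-parity), and the Klein four-group bookkeeping
(route `ManinLocalTwoThree`, crux C2 `ManinOddAtFour` stmt-BirchSwinnertonDyer-22967; cell bsd-f2-manin, C2/C3 LEAD p1 gen 19;
`--supports stmt-BirchSwinnertonDyer-22967`; line card `Lines/kummer_diamond.md` item D6; used by `…KummerDiamondDescentStepTwo`)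

A "representative of conductor `q`" is an integer `D` with `D = 1 ∨ D = q ∨ D = −q ∨ (q = 2 ∧ D = −1)` (the square-free integers whose
square class has conductor dividing a power of the prime `q`; for `q = 2` these are `±1, ±2`).  We prove: such `D` is non-zero in `ℚ`;
`v_q(D') = 0` for a representative `D'` at another prime; `v_q(D) = 1` when `D ≠ 1` and `q` odd; `[D] = 1 ⟹ D = 1`; and the
INDEPENDENCE of non-trivial classes at two / three distinct primes (products are non-trivial).  Plus two lemmas on the four-set
`{1, v₁, v₂, v₁v₂}` in a group of exponent `2`.  Elementary; nothing about C2, Manin's conjecture or BSD is proved here.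
-/

set_option autoImplicit false
-- lint-debt: the directory name repeats the summit name (sibling precedent `ManinLocalTwoThreeKummerDiamondDescentCases.lean`)
set_option linter.dupNamespace false

noncomputable section

open WeierstrassCurve WeierstrassCurve.Affine
open Literature.NumberTheory.EllipticCurves.KramerTwoDescent (exists_eq_mul_sq_of_sqClass_eq)

namespace Summit.BirchSwinnertonDyer.BirchSwinnertonDyer.Theorems.ManinLocalTwoThree.KummerDiamondStepTwo

/-! ## §1 Square classes: valuation parity and sign -/

/-- A trivial square class has even `q`-adic valuation. [folklore] -/
theorem even_padicValRat_of_sqClass_eq_one {x : ℚ} (hx : x ≠ 0) (h : sqClass x = 1) (q : ℕ) [Fact q.Prime] :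
    Even (padicValRat q x) := by
  obtain ⟨u, hu⟩ := (sqClass_eq_one_iff hx).mp h
  rw [hu, padicValRat.pow]
  exact even_two_mul _

/-- A non-zero rational with `q`-adic valuation `1` has non-trivial square class. [folklore] -/
theorem sqClass_ne_one_of_padicValRat_eq_one {x : ℚ} (hx : x ≠ 0) (q : ℕ) [Fact q.Prime] (h : padicValRat q x = 1) :
    sqClass x ≠ 1 := by
  intro h1
  have := even_padicValRat_of_sqClass_eq_one hx h1 q
  rw [h] at this
  exact Int.not_even_one this

/-- Equal square classes of non-zero rationals have the same sign: `0 < x·y`. [folklore] -/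
theorem mul_pos_of_sqClass_eq {x y : ℚ} (hx : x ≠ 0) (hy : y ≠ 0) (h : sqClass x = sqClass y) : 0 < x * y := by
  obtain ⟨r, hr⟩ := exists_eq_mul_sq_of_sqClass_eq hx hy h
  have hr0 : r ≠ 0 := by rintro rfl; exact hx (by rw [hr]; ring)
  rw [hr, show y * r ^ 2 * y = (y * r) ^ 2 by ring]
  exact lt_of_le_of_ne (sq_nonneg _) (Ne.symm (pow_ne_zero 2 (mul_ne_zero hy hr0)))

/-- `sqClass 1 = 1`. [folklore] -/
theorem sqClass_one : sqClass (1 : ℚ) = 1 := by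
  have h := sqClass_sq (1 : ℚ)
  rwa [one_pow] at h

/-- A negative rational has non-trivial square class. [folklore] -/
theorem sqClass_ne_one_of_neg {x : ℚ} (hx : x < 0) : sqClass x ≠ 1 := by
  intro h
  have h' : sqClass x = sqClass (1 : ℚ) := by rw [h, sqClass_one]
  have := mul_pos_of_sqClass_eq hx.ne one_ne_zero h'
  linarith

/-! ## §2 The Klein four-group bookkeeping (any group of exponent `2`) -/

section FourGroup

variable {G : Type*} [CommGroup G]

/-- In a group of exponent `2`, `{1, v₁, v₂, v₁v₂}` is closed under multiplication. [folklore] -/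
theorem fourSet_mul_mem (hG : ∀ g : G, g * g = 1) (v₁ v₂ : G) {a b : G}
    (ha : a = 1 ∨ a = v₁ ∨ a = v₂ ∨ a = v₁ * v₂) (hb : b = 1 ∨ b = v₁ ∨ b = v₂ ∨ b = v₁ * v₂) :
    a * b = 1 ∨ a * b = v₁ ∨ a * b = v₂ ∨ a * b = v₁ * v₂ := by
  have e1 : v₁ * (v₁ * v₂) = v₂ := by rw [← mul_assoc, hG, one_mul]
  have e2 : v₂ * (v₁ * v₂) = v₁ := by rw [mul_comm v₁ v₂, ← mul_assoc, hG, one_mul]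
  have e3 : v₁ * v₂ * v₁ = v₂ := by rw [mul_comm, e1]
  have e4 : v₁ * v₂ * v₂ = v₁ := by rw [mul_comm, e2]
  have e5 : v₁ * v₂ * (v₁ * v₂) = 1 := hG _
  have e6 : v₂ * v₁ = v₁ * v₂ := mul_comm _ _
  rcases ha with rfl | rfl | rfl | rfl <;> rcases hb with rfl | rfl | rfl | rfl <;>
    simp only [one_mul, mul_one, hG, e1, e2, e3, e4, e6, true_or, or_true]

/-- In a group of exponent `2`: two distinct non-trivial elements `a, b` of `{1, v₁, v₂, v₁v₂}` with `ab ≠ 1` exhaust it —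
every element of the four-set is `1, a, b` or `ab`. [folklore] -/
theorem fourSet_eq_of_two_mem (hG : ∀ g : G, g * g = 1) (v₁ v₂ : G) {a b x : G}
    (ha : a = 1 ∨ a = v₁ ∨ a = v₂ ∨ a = v₁ * v₂) (hb : b = 1 ∨ b = v₁ ∨ b = v₂ ∨ b = v₁ * v₂)
    (ha1 : a ≠ 1) (hb1 : b ≠ 1) (hab : a * b ≠ 1)
    (hx : x = 1 ∨ x = v₁ ∨ x = v₂ ∨ x = v₁ * v₂) : x = 1 ∨ x = a ∨ x = b ∨ x = a * b := by
  have e1 : v₁ * (v₁ * v₂) = v₂ := by rw [← mul_assoc, hG, one_mul]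
  have e2 : v₂ * (v₁ * v₂) = v₁ := by rw [mul_comm v₁ v₂, ← mul_assoc, hG, one_mul]
  have e3 : v₁ * v₂ * v₁ = v₂ := by rw [mul_comm, e1]
  have e4 : v₁ * v₂ * v₂ = v₁ := by rw [mul_comm, e2]
  have e6 : v₂ * v₁ = v₁ * v₂ := mul_comm _ _
  rcases ha with rfl | rfl | rfl | rfl
  · exact absurd rfl ha1
  all_goals
    rcases hb with rfl | rfl | rfl | rfl
    · exact absurd rfl hb1
    all_goals
      first
      | exact absurd (hG _) hab
      | (rcases hx with rfl | rfl | rfl | rfl <;>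
          simp only [e1, e2, e3, e4, e6, true_or, or_true])

end FourGroup

/-! ## §3 Representatives of conductor `q` -/

/-- A representative of conductor `q` (`D ∈ {1, q, −q}`, or `−1` at `q = 2`) is non-zero in `ℚ`. [folklore] -/
theorem rep_cast_ne_zero {q : ℕ} (hq : q.Prime) {D : ℤ} (hD : (D = 1 ∨ D = q ∨ D = -q ∨ (q = 2 ∧ D = -1))) : (D : ℚ) ≠ 0 := by
  have hq0 : (q : ℚ) ≠ 0 := by exact_mod_cast hq.ne_zero
  rcases hD with rfl | rfl | rfl | ⟨-, rfl⟩ <;> push_cast <;> simp [hq0]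

/-- `v_q(D') = 0` for a representative `D'` of conductor `q' ≠ q`, `q` odd. [folklore] -/
theorem padicValRat_rep_of_ne {q q' : ℕ} (hq : q.Prime) (hq' : q'.Prime) (hne : q' ≠ q) {D : ℤ}
    (hD : (D = 1 ∨ D = q' ∨ D = -q' ∨ (q' = 2 ∧ D = -1))) : padicValRat q (D : ℚ) = 0 := by
  haveI : Fact q.Prime := ⟨hq⟩
  have hnd : ¬ q ∣ q' := fun h => hne ((Nat.prime_dvd_prime_iff_eq hq hq').mp h).symm
  have hvq' : padicValRat q (q' : ℚ) = 0 := by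
    rw [padicValRat.of_nat, Nat.cast_eq_zero]; exact padicValNat.eq_zero_of_not_dvd hnd
  rcases hD with rfl | rfl | rfl | ⟨-, rfl⟩
  · simp
  · push_cast; exact hvq'
  · push_cast; rw [padicValRat.neg, hvq']
  · push_cast; rw [padicValRat.neg]; simp

/-- `v_q(D) = 1` for a non-trivial representative `D` of odd conductor `q`. [folklore] -/
theorem padicValRat_rep_self {q : ℕ} (hq : q.Prime) (hq2 : q ≠ 2) {D : ℤ} (hD : (D = 1 ∨ D = q ∨ D = -q ∨ (q = 2 ∧ D = -1))) (hD1 : D ≠ 1) :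
    padicValRat q (D : ℚ) = 1 := by
  haveI : Fact q.Prime := ⟨hq⟩
  rcases hD with rfl | rfl | rfl | ⟨h, -⟩
  · exact absurd rfl hD1
  · push_cast; exact padicValRat.self hq.one_lt
  · push_cast; rw [padicValRat.neg]; exact padicValRat.self hq.one_lt
  · exact absurd h hq2

/-- A representative with trivial square class is `1`. [folklore] -/
theorem rep_eq_one_of_sqClass_eq_one {q : ℕ} (hq : q.Prime) {D : ℤ} (hD : (D = 1 ∨ D = q ∨ D = -q ∨ (q = 2 ∧ D = -1))) (h1 : sqClass (D : ℚ) = 1) :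
    D = 1 := by
  by_contra hD1
  by_cases hq2 : q = 2
  · subst hq2
    haveI : Fact (2 : ℕ).Prime := ⟨Nat.prime_two⟩
    rcases hD with rfl | rfl | rfl | ⟨-, rfl⟩
    · exact hD1 rfl
    · exact sqClass_ne_one_of_padicValRat_eq_one (by norm_num) 2
        (by push_cast; exact padicValRat.self one_lt_two) h1
    · exact sqClass_ne_one_of_padicValRat_eq_one (by norm_num) 2
        (by push_cast; rw [padicValRat.neg]; exact padicValRat.self one_lt_two) h1
    · exact sqClass_ne_one_of_neg (by push_cast; norm_num) h1
  · haveI : Fact q.Prime := ⟨hq⟩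
    exact sqClass_ne_one_of_padicValRat_eq_one (rep_cast_ne_zero hq hD) q (padicValRat_rep_self hq hq2 hD hD1) h1

/-! ## §4 Independence of non-trivial classes at distinct primes -/

/-- Core of the independence: an odd prime `q` with a non-trivial class, times a class at `q' ≠ q`, is non-trivial. [folklore] -/
theorem indep_two_of_odd {q q' : ℕ} (hq : q.Prime) (hq' : q'.Prime) (hne : q ≠ q') (hq2 : q ≠ 2) {a₁ a₂ b₁ b₂ : ℤ}
    (ha₁ : (a₁ = 1 ∨ a₁ = q ∨ a₁ = -q ∨ (q = 2 ∧ a₁ = -1))) (ha₂ : (a₂ = 1 ∨ a₂ = q ∨ a₂ = -q ∨ (q = 2 ∧ a₂ = -1))) (hb₁ : (b₁ = 1 ∨ b₁ = q' ∨ b₁ = -q' ∨ (q' = 2 ∧ b₁ = -1))) (hb₂ : (b₂ = 1 ∨ b₂ = q' ∨ b₂ = -q' ∨ (q' = 2 ∧ b₂ = -1)))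
    (hnt : ¬ (a₁ = 1 ∧ a₂ = 1)) :
    (sqClass (a₁ : ℚ), sqClass (a₂ : ℚ)) * (sqClass (b₁ : ℚ), sqClass (b₂ : ℚ)) ≠ (1 : SqUnits ℚ × SqUnits ℚ) := by
  intro heq
  haveI : Fact q.Prime := ⟨hq⟩
  rw [Prod.mk_mul_mk, Prod.mk_eq_one] at heq
  have h01 := rep_cast_ne_zero hq ha₁
  have h02 := rep_cast_ne_zero hq ha₂
  have h01' := rep_cast_ne_zero hq' hb₁
  have h02' := rep_cast_ne_zero hq' hb₂
  by_cases hd : a₁ = 1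
  · have hd2 : a₂ ≠ 1 := fun h => hnt ⟨hd, h⟩
    have hval : padicValRat q ((a₂ : ℚ) * (b₂ : ℚ)) = 1 := by
      rw [padicValRat.mul h02 h02', padicValRat_rep_self hq hq2 ha₂ hd2, padicValRat_rep_of_ne hq hq' hne.symm hb₂, add_zero]
    exact sqClass_ne_one_of_padicValRat_eq_one (mul_ne_zero h02 h02') q hval (by rw [sqClass_mul h02 h02']; exact heq.2)
  · have hval : padicValRat q ((a₁ : ℚ) * (b₁ : ℚ)) = 1 := by
      rw [padicValRat.mul h01 h01', padicValRat_rep_self hq hq2 ha₁ hd, padicValRat_rep_of_ne hq hq' hne.symm hb₁, add_zero]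
    exact sqClass_ne_one_of_padicValRat_eq_one (mul_ne_zero h01 h01') q hval (by rw [sqClass_mul h01 h01']; exact heq.1)

/-- **Independence at two primes**: non-trivial classes of conductors `q ≠ q'` have non-trivial product. [folklore] -/
theorem indep_two {q q' : ℕ} (hq : q.Prime) (hq' : q'.Prime) (hne : q ≠ q') {a₁ a₂ b₁ b₂ : ℤ}
    (ha₁ : (a₁ = 1 ∨ a₁ = q ∨ a₁ = -q ∨ (q = 2 ∧ a₁ = -1))) (ha₂ : (a₂ = 1 ∨ a₂ = q ∨ a₂ = -q ∨ (q = 2 ∧ a₂ = -1))) (hb₁ : (b₁ = 1 ∨ b₁ = q' ∨ b₁ = -q' ∨ (q' = 2 ∧ b₁ = -1))) (hb₂ : (b₂ = 1 ∨ b₂ = q' ∨ b₂ = -q' ∨ (q' = 2 ∧ b₂ = -1)))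
    (hnt : ¬ (a₁ = 1 ∧ a₂ = 1)) (hnt' : ¬ (b₁ = 1 ∧ b₂ = 1)) :
    (sqClass (a₁ : ℚ), sqClass (a₂ : ℚ)) * (sqClass (b₁ : ℚ), sqClass (b₂ : ℚ)) ≠ (1 : SqUnits ℚ × SqUnits ℚ) := by
  by_cases hq2 : q = 2
  · have hq'2 : q' ≠ 2 := fun h => hne (hq2.trans h.symm)
    rw [mul_comm]
    exact indep_two_of_odd hq' hq hne.symm hq'2 hb₁ hb₂ ha₁ ha₂ hnt'
  · exact indep_two_of_odd hq hq' hne hq2 ha₁ ha₂ hb₁ hb₂ hnt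

/-- Core of the triple independence (odd `q` non-trivial). [folklore] -/
theorem indep_three_of_odd {q q' q'' : ℕ} (hq : q.Prime) (hq' : q'.Prime) (hq'' : q''.Prime) (hne : q ≠ q') (hne' : q ≠ q'')
    (hq2 : q ≠ 2) {a₁ a₂ b₁ b₂ c₁ c₂ : ℤ}
    (ha₁ : (a₁ = 1 ∨ a₁ = q ∨ a₁ = -q ∨ (q = 2 ∧ a₁ = -1))) (ha₂ : (a₂ = 1 ∨ a₂ = q ∨ a₂ = -q ∨ (q = 2 ∧ a₂ = -1))) (hb₁ : (b₁ = 1 ∨ b₁ = q' ∨ b₁ = -q' ∨ (q' = 2 ∧ b₁ = -1))) (hb₂ : (b₂ = 1 ∨ b₂ = q' ∨ b₂ = -q' ∨ (q' = 2 ∧ b₂ = -1)))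
    (hc₁ : (c₁ = 1 ∨ c₁ = q'' ∨ c₁ = -q'' ∨ (q'' = 2 ∧ c₁ = -1))) (hc₂ : (c₂ = 1 ∨ c₂ = q'' ∨ c₂ = -q'' ∨ (q'' = 2 ∧ c₂ = -1))) (hnt : ¬ (a₁ = 1 ∧ a₂ = 1)) :
    (sqClass (a₁ : ℚ), sqClass (a₂ : ℚ)) * ((sqClass (b₁ : ℚ), sqClass (b₂ : ℚ)) * (sqClass (c₁ : ℚ), sqClass (c₂ : ℚ))) ≠
      (1 : SqUnits ℚ × SqUnits ℚ) := by
  intro heq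
  haveI : Fact q.Prime := ⟨hq⟩
  rw [Prod.mk_mul_mk, Prod.mk_mul_mk, Prod.mk_eq_one] at heq
  have h01 := rep_cast_ne_zero hq ha₁
  have h02 := rep_cast_ne_zero hq ha₂
  have h01' := rep_cast_ne_zero hq' hb₁
  have h02' := rep_cast_ne_zero hq' hb₂
  have h01'' := rep_cast_ne_zero hq'' hc₁
  have h02'' := rep_cast_ne_zero hq'' hc₂
  by_cases hd : a₁ = 1
  · have hd2 : a₂ ≠ 1 := fun h => hnt ⟨hd, h⟩
    have hval : padicValRat q ((a₂ : ℚ) * ((b₂ : ℚ) * (c₂ : ℚ))) = 1 := by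
      rw [padicValRat.mul h02 (mul_ne_zero h02' h02''), padicValRat.mul h02' h02'', padicValRat_rep_self hq hq2 ha₂ hd2,
        padicValRat_rep_of_ne hq hq' hne.symm hb₂, padicValRat_rep_of_ne hq hq'' hne'.symm hc₂]; norm_num
    exact sqClass_ne_one_of_padicValRat_eq_one (mul_ne_zero h02 (mul_ne_zero h02' h02'')) q hval
      (by rw [sqClass_mul h02 (mul_ne_zero h02' h02''), sqClass_mul h02' h02'']; exact heq.2)
  · have hval : padicValRat q ((a₁ : ℚ) * ((b₁ : ℚ) * (c₁ : ℚ))) = 1 := by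
      rw [padicValRat.mul h01 (mul_ne_zero h01' h01''), padicValRat.mul h01' h01'', padicValRat_rep_self hq hq2 ha₁ hd,
        padicValRat_rep_of_ne hq hq' hne.symm hb₁, padicValRat_rep_of_ne hq hq'' hne'.symm hc₁]; norm_num
    exact sqClass_ne_one_of_padicValRat_eq_one (mul_ne_zero h01 (mul_ne_zero h01' h01'')) q hval
      (by rw [sqClass_mul h01 (mul_ne_zero h01' h01''), sqClass_mul h01' h01'']; exact heq.1)

/-- **Independence at three primes**: non-trivial classes of pairwise distinct conductors have non-trivial triple product. [folklore] -/
theorem indep_three {q q' q'' : ℕ} (hq : q.Prime) (hq' : q'.Prime) (hq'' : q''.Prime) (hne : q ≠ q') (hne' : q ≠ q'')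
    (hne'' : q' ≠ q'') {a₁ a₂ b₁ b₂ c₁ c₂ : ℤ}
    (ha₁ : (a₁ = 1 ∨ a₁ = q ∨ a₁ = -q ∨ (q = 2 ∧ a₁ = -1))) (ha₂ : (a₂ = 1 ∨ a₂ = q ∨ a₂ = -q ∨ (q = 2 ∧ a₂ = -1))) (hb₁ : (b₁ = 1 ∨ b₁ = q' ∨ b₁ = -q' ∨ (q' = 2 ∧ b₁ = -1))) (hb₂ : (b₂ = 1 ∨ b₂ = q' ∨ b₂ = -q' ∨ (q' = 2 ∧ b₂ = -1)))
    (hc₁ : (c₁ = 1 ∨ c₁ = q'' ∨ c₁ = -q'' ∨ (q'' = 2 ∧ c₁ = -1))) (hc₂ : (c₂ = 1 ∨ c₂ = q'' ∨ c₂ = -q'' ∨ (q'' = 2 ∧ c₂ = -1))) (hnt : ¬ (a₁ = 1 ∧ a₂ = 1)) (hnt' : ¬ (b₁ = 1 ∧ b₂ = 1)) :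
    (sqClass (a₁ : ℚ), sqClass (a₂ : ℚ)) * ((sqClass (b₁ : ℚ), sqClass (b₂ : ℚ)) * (sqClass (c₁ : ℚ), sqClass (c₂ : ℚ))) ≠
      (1 : SqUnits ℚ × SqUnits ℚ) := by
  by_cases hq2 : q = 2
  · have hq'2 : q' ≠ 2 := fun h => hne (hq2.trans h.symm)
    rw [mul_left_comm]
    exact indep_three_of_odd hq' hq hq'' hne.symm hne'' hq'2 hb₁ hb₂ ha₁ ha₂ hc₁ hc₂ hnt'
  · exact indep_three_of_odd hq hq' hq'' hne hne' hq2 ha₁ ha₂ hb₁ hb₂ hc₁ hc₂ hnt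

end Summit.BirchSwinnertonDyer.BirchSwinnertonDyer.Theorems.ManinLocalTwoThree.KummerDiamondStepTwo

end
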